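import Mathlib
import HarnessLib
import Literature.Analysis.FluidPDE.SuitableWeak
import Literature.Analysis.FluidPDE.SelfSimilar
import Literature.Analysis.FluidPDE.LocalTypeI
import Literature.Analysis.FluidPDE.ESSLocalHolderNoConcentration
import Summits.NavierStokesRegularity.NavierStokesRegularity.Theorems.RellichScarNoMildScar

/-!
# The far-field representative on a half-space (line calm-cone-carleman, crux ApexLocalisation stmt-NavierStokesRegularity-11719, stub `stub_halfspaceFarFieldRepresentative`)

Step S3 of the half-space Liouville theorem of the line `calm-cone-carleman`: the inputs of the
far-field backward-uniqueness step S2.  Setting: `(w, π)` is a suitable weak solution of the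
Navier–Stokes system on the backward slab `]-∞, 0[ × ℝ³` with a weak spatial gradient `H` and
`𝐈 < ∞`, `|w| ≤ 1` a.e. on `]-2, 0[ × {x | R₀ < ⟪x, e⟫}` (`‖e‖ = 1`), and `w` is uniformly small
near the top time there.  Conclusion: on `Ω = ]-1, 0[ × {x | R₀ + 1 < ⟪x, e⟫}` the field `w` has a
jointly continuous representative `Uf`, `C⁴` in space with jointly continuous spatial
derivatives `D_xⁿUf` (`n ≤ 4`) and `‖D_xⁿUf‖ ≤ K` (`n ≤ 3`), solving the Navier–Stokes system on
`Ω` in the sense of distributions with the ORIGINAL pressure `π`; moreover the cut-off field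
`w·1_{⟪x, e⟫ > R₀}` equals `Uf` a.e. on `Ω` and its slices vanish weakly at the top time.

Proof: the template `RellichScarNoMildScar.apex_farField_representative` (Escauriaza–Seregin–Šverák
2003, §3, (3.26)–(3.30); Lemarié-Rieusset 2016, proof of Thm. 15.4, Step 2) with the exterior of
a ball replaced by a half-space.  Around every point of `Ω` the cylinder `Q((t + 1/4) ∧ 0, x; 1)`
lies in `]-2, 0[ × {⟪x, e⟫ > R₀}`, where `|w| ≤ 1`, and in the per-cylinder pressure gauge
`π − [π]_{B(x, 1)}` (`sub_ballMean_slab`) the `L^{3/2}` norm of the pressure is at most `𝐈`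
(`lintegral_sub_ballMean_le_typeIBound`); Serrin's interior regularity theory for bounded
solutions with the uniform derivative bounds (`NSBoundedHigherRegularityBounds_holds`) glued over
`Ω` (`exists_smooth_representative_of_locally_bounded_gauge`) gives the representative.  The weak
vanishing of the cut-off field at the top is immediate from the uniform smallness (Fubini and
`|∫ ⟪w 1_{⟪·, e⟫ > R₀}(s), φ⟫| ≤ ε' ‖φ‖₁`).

* `stub_halfspaceFarFieldRepresentative` — the statement S3.

References: L. Escauriaza, G. Seregin, V. Šverák, *`L_{3,∞}`-solutions of Navier–Stokes equations
and backward uniqueness*, Russ. Math. Surveys 58 (2003) 211–250, §3 (3.26)–(3.30)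
[EscauriazaSereginSverak2003]; P. G. Lemarié-Rieusset, *The Navier–Stokes problem in the 21st
century*, CRC Press 2016, proof of Thm. 15.4, Step 2 [LemarieRieusset2016].
-/

noncomputable section

set_option linter.dupNamespace false

namespace Summit.NavierStokesRegularity.NavierStokesRegularity.Theorems.RellichScarApexLocalisation

open MeasureTheory Set Function Metric Filter Topology TopologicalSpace
open scoped ENNReal NNReal InnerProductSpace RealInnerProductSpace
open Literature.Analysis Literature.Analysis.FluidPDE
open Summit.NavierStokesRegularity.NavierStokesRegularity.Theorems.RellichScarNoMildScar

local notation "E³" => EuclideanSpace ℝ (Fin 3)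

/-- The open backward slab `(-∞, 0) × ℝ³` (time first). -/
local notation "𝕊" => Literature.Analysis.FluidPDE.slab (EuclideanSpace ℝ (Fin 3)) (Set.Iio (0 : ℝ)) isOpen_Iio

/-! ### Geometry of the half-space far region -/

/-- **The unit thickening of `{⟪x, e⟫ > R₀ + 1}` lies in `{⟪x, e⟫ > R₀}`** (`‖e‖ = 1`): if
`R₀ + 1 < ⟪x, e⟫` and `‖y - x‖ < 1` then `⟪y, e⟫ ≥ ⟪x, e⟫ - ‖y - x‖ > R₀` (Cauchy–Schwarz). [folklore] -/
private theorem halfspaceFarField_ball_subset {e : E³} (he : ‖e‖ = 1) {R₀ : ℝ} {x : E³}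
    (hx : R₀ + 1 < ⟪x, e⟫) : ball x (2 * (1 / 2 : ℝ)) ⊆ {y : E³ | R₀ < ⟪y, e⟫} := by
  intro y hy
  rw [mem_ball, dist_eq_norm] at hy
  have h1 : |⟪y - x, e⟫| ≤ ‖y - x‖ * ‖e‖ := abs_real_inner_le_norm (y - x) e
  rw [he, mul_one, inner_sub_left, abs_le] at h1
  show R₀ < ⟪y, e⟫
  linarith [h1.1]

/-! ### Weak vanishing of the cut-off field at the top time -/

/-- **Uniform smallness near the top implies weak vanishing of the cut-off slices.**  If for
every `ε > 0` there is `s₀ < 0` with `|w| ≤ ε` a.e. on `]s₀, 0[ × {⟪x, e⟫ > R₀}`, then for every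
continuous compactly supported `φ` and `ε > 0` there is `s₀ < 0` with
`|∫ ⟪w 1_{⟪·, e⟫ > R₀}(s), φ⟫| ≤ ε` for a.e. `s ∈ ]s₀, 0[`: by Fubini, for a.e. such `s` the
slice bound holds a.e. in space, and `|∫ ⟪w 1_{⟪·, e⟫ > R₀}(s), φ⟫| ≤ ε' ‖φ‖₁` with
`ε' = ε / (‖φ‖₁ + 1)`. [folklore] -/
private theorem halfspaceFarField_weakTop {w : ℝ → E³ → E³} {e : E³} {R₀ : ℝ}
    (hsmall : ∀ ε : ℝ, 0 < ε → ∃ s₀ : ℝ, s₀ < 0 ∧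
      ∀ᵐ z ∂(volume.restrict (Ioo s₀ 0 ×ˢ {x : E³ | R₀ < ⟪x, e⟫})), ‖w z.1 z.2‖ ≤ ε)
    (φ : E³ → E³) (hφ : Continuous φ) (hφc : HasCompactSupport φ) {ε : ℝ} (hε : 0 < ε) :
    ∃ s₀ : ℝ, s₀ < 0 ∧ ∀ᵐ s ∂(volume.restrict (Ioo s₀ 0)),
      |∫ y, ⟪(if R₀ < ⟪y, e⟫ then w s y else 0), φ y⟫| ≤ ε := by
  have hφi : Integrable φ := hφ.integrable_of_hasCompactSupport hφc
  set M : ℝ := ∫ y, ‖φ y‖ with hM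
  have hM0 : 0 ≤ M := integral_nonneg fun _ => norm_nonneg _
  have hε' : 0 < ε / (M + 1) := div_pos hε (by linarith)
  obtain ⟨s₀, hs₀, hsm⟩ := hsmall (ε / (M + 1)) hε'
  refine ⟨s₀, hs₀, ?_⟩
  have hB : MeasurableSet {x : E³ | R₀ < ⟪x, e⟫} :=
    (isOpen_lt continuous_const (continuous_id.inner continuous_const)).measurableSet
  have h1 : ∀ᵐ z ∂((volume.restrict (Ioo s₀ 0)).prod (volume.restrict {x : E³ | R₀ < ⟪x, e⟫})),
      ‖w z.1 z.2‖ ≤ ε / (M + 1) := by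
    rw [Measure.prod_restrict, ← Measure.volume_eq_prod]
    exact hsm
  filter_upwards [Measure.ae_ae_of_ae_prod h1] with s hs
  have hs' : ∀ᵐ y, y ∈ {x : E³ | R₀ < ⟪x, e⟫} → ‖w s y‖ ≤ ε / (M + 1) :=
    (ae_restrict_iff' hB).1 hs
  have hpt : ∀ᵐ y, ‖⟪(if R₀ < ⟪y, e⟫ then w s y else 0), φ y⟫‖ ≤ ε / (M + 1) * ‖φ y‖ := by
    filter_upwards [hs'] with y hy
    by_cases hyB : R₀ < ⟪y, e⟫
    · rw [if_pos hyB]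
      exact (norm_inner_le_norm _ _).trans (mul_le_mul_of_nonneg_right (hy hyB) (norm_nonneg _))
    · rw [if_neg hyB, inner_zero_left, norm_zero]
      positivity
  have hint : ∫ y, ε / (M + 1) * ‖φ y‖ = ε / (M + 1) * M := by
    rw [integral_const_mul]
  calc |∫ y, ⟪(if R₀ < ⟪y, e⟫ then w s y else 0), φ y⟫|
      = ‖∫ y, ⟪(if R₀ < ⟪y, e⟫ then w s y else 0), φ y⟫‖ := (Real.norm_eq_abs _).symm
    _ ≤ ∫ y, ε / (M + 1) * ‖φ y‖ := norm_integral_le_of_norm_le (hφi.norm.const_mul _) hpt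
    _ = ε / (M + 1) * M := hint
    _ ≤ ε := by
        rw [div_mul_eq_mul_div, div_le_iff₀ (by linarith)]
        nlinarith [hε.le, hM0]

/-! ### S3 — the far-field representative on a half-space -/

/-- **S3: the far-field representative on a half-space** (Escauriaza–Seregin–Šverák 2003, §3,
(3.26)–(3.30); Lemarié-Rieusset 2016, proof of Thm. 15.4, Step 2; the tree's
`RellichScarNoMildScar.apex_farField_representative` with `{|x| > R₀ + 1}` replaced by the
half-space `{⟪x, e⟫ > R₀ + 1}`).  If `(w, π)` is a suitable weak slab solution with weak
gradient `H`, `𝐈 < ⊤`, `|w| ≤ 1` a.e. on `]-2, 0[ × {⟪x, e⟫ > R₀}` and `w` is uniformly small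
near the top there (`∀ ε, ∃ s₀ < 0, |w| ≤ ε` a.e. on `]s₀, 0[ × {⟪x, e⟫ > R₀}`), then on
`Ω = ]-1, 0[ × {⟪x, e⟫ > R₀ + 1}` the field `w` has a jointly continuous representative `Uf`,
smooth in space with jointly continuous spatial derivatives and `‖D_xⁿUf‖ ≤ K` (`n ≤ 3`),
solving Navier–Stokes on `Ω` with the pressure `π` (Serrin's theory through
`exists_smooth_representative_of_locally_bounded_gauge` in the per-cylinder pressure gauge), and
the cut-off field `w·1_{⟪x, e⟫ > R₀}` (equal to `Uf` a.e. on `Ω`) has slices vanishing weakly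
at the top.
[cite: EscauriazaSereginSverak2003, §3 (3.26)-(3.30)] [cite: LemarieRieusset2016, proof of Thm. 15.4, Step 2] -/
theorem stub_halfspaceFarFieldRepresentative :
    ∀ (e : E³), ‖e‖ = 1 → ∀ (R₀ : ℝ), 0 < R₀ →
      ∀ (w : ℝ → E³ → E³) (π : ℝ → E³ → ℝ) (H : ℝ → E³ → E³ →L[ℝ] E³),
      IsSuitableWeakSolutionOn 𝕊 1 0 w π → HasWeakSpatialGradientOn 𝕊 w H →
      typeIBound (Iio (0 : ℝ) ×ˢ univ) w π H < ⊤ →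
      (∀ᵐ z ∂(volume.restrict (Ioo (-2 : ℝ) 0 ×ˢ {x : E³ | R₀ < ⟪x, e⟫})), ‖w z.1 z.2‖ ≤ 1) →
      (∀ ε : ℝ, 0 < ε → ∃ s₀ : ℝ, s₀ < 0 ∧
        ∀ᵐ z ∂(volume.restrict (Ioo s₀ 0 ×ˢ {x : E³ | R₀ < ⟪x, e⟫})), ‖w z.1 z.2‖ ≤ ε) →
      ∃ (Uf : ℝ → E³ → E³) (K : ℝ),
        uncurry Uf =ᵐ[volume.restrict (Ioo (-1 : ℝ) 0 ×ˢ {x : E³ | R₀ + 1 < ⟪x, e⟫})] uncurry w ∧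
        ContinuousOn (uncurry Uf) (Ioo (-1 : ℝ) 0 ×ˢ {x : E³ | R₀ + 1 < ⟪x, e⟫}) ∧
        (∀ φ : E³ → E³, ContDiff ℝ (⊤ : ℕ∞) φ → HasCompactSupport φ → ∀ ε : ℝ, 0 < ε →
          ∃ s₀ : ℝ, s₀ < 0 ∧ ∀ᵐ s ∂(volume.restrict (Ioo s₀ 0)),
            |∫ y, ⟪(if R₀ < ⟪y, e⟫ then w s y else 0), φ y⟫| ≤ ε) ∧
        (uncurry Uf =ᵐ[volume.restrict (Ioo (-1 : ℝ) 0 ×ˢ {x : E³ | R₀ + 1 < ⟪x, e⟫})]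
          fun z => if R₀ < ⟪z.2, e⟫ then w z.1 z.2 else 0) ∧
        IsDistributionalNSSolutionOn ⟨Ioo (-1 : ℝ) 0 ×ˢ {x : E³ | R₀ + 1 < ⟪x, e⟫},
          isOpen_Ioo.prod (isOpen_lt continuous_const (continuous_id.inner continuous_const))⟩ 1 0 Uf π ∧
        (∀ t ∈ Ioo (-1 : ℝ) 0, ContDiffOn ℝ 4 (Uf t) {x : E³ | R₀ + 1 < ⟪x, e⟫}) ∧
        (∀ n ≤ 4, ContinuousOn (fun z : ℝ × E³ => iteratedFDeriv ℝ n (Uf z.1) z.2)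
          (Ioo (-1 : ℝ) 0 ×ˢ {x : E³ | R₀ + 1 < ⟪x, e⟫})) ∧
        (∀ n ≤ 3, ∀ z ∈ Ioo (-1 : ℝ) 0 ×ˢ {x : E³ | R₀ + 1 < ⟪x, e⟫}, ‖iteratedFDeriv ℝ n (Uf z.1) z.2‖ ≤ K) := by
  intro e he R₀ _hR₀ w π H hsw _hwg hI hfar hsmall
  set I : ℝ≥0∞ := typeIBound (Iio (0 : ℝ) ×ˢ (univ : Set E³)) w π H with hIdef
  have hItop : I ≠ ⊤ := hI.ne
  set S : Set E³ := {x : E³ | R₀ + 1 < ⟪x, e⟫} with hS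
  have hSo : IsOpen S := isOpen_lt continuous_const (continuous_id.inner continuous_const)
  -- the thickening condition
  have hSS' : ∀ x ∈ S, ball x (2 * (1 / 2 : ℝ)) ⊆ {y : E³ | R₀ < ⟪y, e⟫} := fun x hx =>
    halfspaceFarField_ball_subset he hx
  -- ## the representative, cylinder by cylinder in the local gauge
  set P : ℝ≥0 := (ENNReal.ofReal (2 * (1 / 2 : ℝ)) ^ 2 * I).toNNReal with hP
  have hPeq : ((P : ℝ≥0) : ℝ≥0∞) = ENNReal.ofReal (2 * (1 / 2 : ℝ)) ^ 2 * I :=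
    ENNReal.coe_toNNReal (ENNReal.mul_ne_top (ENNReal.pow_ne_top ENNReal.ofReal_ne_top) hItop)
  have hloc : ∀ z ∈ Ioo (-1 : ℝ) 0 ×ˢ S, ∃ πz : ℝ → E³ → ℝ,
      IsDistributionalNSSolutionOn
        (parabolicCylinderOpens (2 * (1 / 2 : ℝ)) (min (z.1 + (1 / 2 : ℝ) ^ 2) 0, z.2)) 1 0 w πz ∧
      (∀ᵐ q ∂(volume.restrict (parabolicCylinder (2 * (1 / 2 : ℝ)) (min (z.1 + (1 / 2 : ℝ) ^ 2) 0, z.2))),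
        ‖w q.1 q.2‖ ≤ (1 : ℝ)) ∧
      ∫⁻ q in parabolicCylinder (2 * (1 / 2 : ℝ)) (min (z.1 + (1 / 2 : ℝ) ^ 2) 0, z.2),
        ‖πz q.1 q.2‖ₑ ^ (3 / 2 : ℝ) ≤ P := by
    rintro ⟨t, x⟩ ⟨ht, hx⟩
    set z₀ : ℝ × E³ := (min (t + (1 / 2 : ℝ) ^ 2) 0, x) with hz₀
    have hz₀t : z₀.1 ≤ 0 := min_le_right _ _
    refine ⟨fun s y => π s y - ⨍ y' in ball z₀.2 (2 * (1 / 2 : ℝ)), π s y', ?_, ?_, ?_⟩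
    · exact ((sub_ballMean_slab hsw z₀.2 (by norm_num : (0 : ℝ) < 2 * (1 / 2))).of_le
        (parabolicCylinderOpens_le_slab _ hz₀t)).distributional
    · -- the cylinder lies in the far region
      have hcyl : parabolicCylinder (2 * (1 / 2 : ℝ)) z₀ ⊆
          Ioo (-2 : ℝ) 0 ×ˢ {y : E³ | R₀ < ⟪y, e⟫} := by
        rintro ⟨s, y⟩ hq
        rw [mem_parabolicCylinder] at hq
        obtain ⟨⟨hs1, hs2⟩, hy⟩ := hq
        refine ⟨⟨?_, lt_of_lt_of_le hs2 hz₀t⟩, hSS' x hx (mem_ball.2 hy)⟩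
        have h1 : -1 < min (t + (1 / 2 : ℝ) ^ 2) 0 := lt_min (by linarith [ht.1]) (by norm_num)
        have h2 : z₀.1 = min (t + (1 / 2 : ℝ) ^ 2) 0 := rfl
        rw [h2] at hs1
        nlinarith
      exact ae_restrict_of_ae_restrict_of_subset hcyl hfar
    · rw [hPeq]
      exact lintegral_sub_ballMean_le_typeIBound (by norm_num) hz₀t w π H
  obtain ⟨K, U, hUw, hUc, hCD, hjc, hbdK⟩ := exists_smooth_representative_of_locally_bounded_gauge
    NSBoundedHigherRegularityBounds_holds hSo (by norm_num : (0 : ℝ) < 1 / 2) hloc 4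
  -- ## the equations on the far region and the regularity of the representative
  set Ω : Set (ℝ × E³) := Ioo (-1 : ℝ) 0 ×ˢ S with hΩ
  have hΩo : IsOpen Ω := isOpen_Ioo.prod hSo
  have hΩle : (⟨Ω, hΩo⟩ : Opens (ℝ × E³)) ≤ (slab E³ (Iio (0 : ℝ)) isOpen_Iio) := by
    intro z hz
    rw [mem_slab]
    exact hz.1.2
  have hsolw : IsDistributionalNSSolutionOn ⟨Ω, hΩo⟩ 1 0 w π := (hsw.of_le hΩle).distributional
  have hsol : IsDistributionalNSSolutionOn ⟨Ω, hΩo⟩ 1 0 U π :=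
    hsolw.congr_ae hUw.symm (ae_of_all _ fun _ => rfl)
  have hU4 : ∀ t ∈ Ioo (-1 : ℝ) 0, ContDiffOn ℝ 4 (U t) S := fun t ht x hx =>
    ((hCD (t, x) ⟨ht, hx⟩).of_le (by norm_cast)).contDiffWithinAt
  have hΦ : ∀ n ≤ 4, ContinuousOn (fun z : ℝ × E³ => iteratedFDeriv ℝ n (U z.1) z.2) Ω :=
    fun n _ => hjc n
  have hK : ∀ n ≤ 3, ∀ z ∈ Ω, ‖iteratedFDeriv ℝ n (U z.1) z.2‖ ≤ K := fun n hn z hz =>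
    hbdK n (by omega) z hz
  -- ## the cut-off field agrees with `w`, hence with `U`, on the far region
  have hcut : uncurry U =ᵐ[volume.restrict Ω] fun z => if R₀ < ⟪z.2, e⟫ then w z.1 z.2 else 0 := by
    refine hUw.trans ?_
    filter_upwards [ae_restrict_mem (measurableSet_Ioo.prod hSo.measurableSet)] with z hz
    have hz2 : R₀ + 1 < ⟪z.2, e⟫ := hz.2
    show w z.1 z.2 = if R₀ < ⟪z.2, e⟫ then w z.1 z.2 else 0
    rw [if_pos (by linarith)]
  exact ⟨U, K, hUw, hUc,
    fun φ hφ hφc ε hε => halfspaceFarField_weakTop hsmall φ hφ.continuous hφc hε,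
    hcut, hsol, hU4, hΦ, hK⟩

end Summit.NavierStokesRegularity.NavierStokesRegularity.Theorems.RellichScarApexLocalisation

end
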